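import Literature.MathematicalPhysics.QuantumFieldTheory.Balaban1983to89.B9RWSums346MixedFactorAtRecord

/-!
# `Balaban1983to89.B9RWSums346MixedFactorAtRecordClosed` — [B9] (3.88)–(3.89) ∕ (3.46) ∕ Cor 3.6: rows 18's `FactorsL2Mixed37Dir` AT THE RECORD,
# this seat's theorem `B9RWSums346MixedFactorAtRecord.factorsL2Mixed37Dir_memberY_record` WITH ITS FOUR EXISTENTIAL CONSTANTS NAMED (`MRec aRec BRec δRec`) —
# the closed terms the certificate's displayed numerics (`p.M₁`, `p.a₁`, `pM.θM`, `p.δ₀`) and its `NumericsWitness` are compared with — and the theorem restated AT THEM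

T. Bałaban, *Propagators for lattice gauge theories in a background field*, Commun. Math. Phys. **99** (1985) 389–434 [`Balaban1985BackgroundPropagators`, "B9"],
(3.88)–(3.89) p. 409, (3.46) p. 398, Cor 3.6 p. 408, (3.35) p. 396; T. Bałaban, *Propagators and renormalization transformations for lattice gauge theories. II*,
Commun. Math. Phys. **96** (1984) 223–250 [`Balaban1984PropagatorsII`], (2.39)–(2.44) pp. 229–230, (2.52)–(2.55) p. 232, Lemma 2.1 (2.59)–(2.61) pp. 233–234.

statement-level skeleton of published theorems with citation tags; proofs where landed; nothing here is a claim about the Yang–Mills mass gap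

WHY THIS FILE (cell `pub-ymgap`, Track A node N06 [B9], rows 18; width seat `pub-ymgap-dag-n06-w7`, g2, 2026-08-28).  The pattern of this seat's drills
`B9Eq346GradGpDivAtPinsL2Closed` ∕ `B9Eq346MixedLegAtPinsL2Closed` ∕ `B9RWSums346MixedFactorAtPinsClosed` (asked for by the knit owner dag-n06-d: supplier `∃`-constants that
meet displayed numerics must be NAMED): `factorsL2Mixed37Dir_memberY_record` concludes `∃ MK aK BK δK > 0, ∀ …`; a certificate edition that consumes it compares its displayed
numerics with THESE constants, so they are named once here by `Classical.choose` (`MRec aRec BRec δRec`, functions of `d ℓ b₀ b₁ M⋆ N c₀` and the members' site `Fintype`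
structure), their signs recorded (`_pos`), and the theorem restated at them (★★★ `factorsL2Mixed37Dir_memberY_record_at`).  Nothing else.

HONEST SCOPE.  Four `Classical.choose` definitions + one restatement; no analysis; nothing of [B9] asserted beyond the kernel-checked parent; COUNT-NEUTRAL; N06 NOT
discharged; K1⁹ NOT closed; nothing continuum ∕ OS ∕ mass gap ∕ Clay.  NEW file (definition lane: 4 `def`); nothing landed is modified.
-/

noncomputable section

namespace Literature.MathematicalPhysics.QuantumFieldTheory.Balaban1983to89.B9RWSums346MixedFactorAtRecordClosed

open Literature.MathematicalPhysics.QuantumFieldTheory.Balaban1983to89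
open Node00 B6KLevelCensusIndexV1 B6Geom246MultiLevelBox B6MultiLevelTorusOperator B6GlobalChartV1 B9BackgroundsKLevelV1 B6Geom246MultiLevelTorus
open Literature.MathematicalPhysics.QuantumFieldTheory.Balaban1983to89.B6Ineq2142KLevelV1 (lvl β)
open Literature.MathematicalPhysics.QuantumFieldTheory.Balaban1983to89.B9Ineq349SiteComposite (cdSL cdsSL)
open Literature.MathematicalPhysics.QuantumFieldTheory.Balaban1983to89.B9CoReadingCoords (coordOpK)
open Literature.MathematicalPhysics.QuantumFieldTheory.Balaban1983to89.B9CoReadingCoordsS (XSK blkSK sIK)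
open Literature.MathematicalPhysics.QuantumFieldTheory.Balaban1983to89.B9CoReadingCoordsTranspose (TrIdx trBasis)
open Literature.MathematicalPhysics.QuantumFieldTheory.Balaban1983to89.B9PinMembersKLevelV1 (MemberY geo9Y bg9Y)
open Literature.MathematicalPhysics.QuantumFieldTheory.Balaban1983to89.B9Thm37Sum (mulOp)
open Literature.MathematicalPhysics.QuantumFieldTheory.Balaban1983to89.B9Thm37Glue (IsTransposePair)
open Literature.MathematicalPhysics.QuantumFieldTheory.Balaban1983to89.B9Thm37Whole (Ops StaticOK Sizes)
open Literature.MathematicalPhysics.QuantumFieldTheory.Balaban1983to89.B9Thm37WholeDir (DirLetters37 Identities₂)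
open Literature.MathematicalPhysics.QuantumFieldTheory.Balaban1983to89.B9Thm37KLetterDir (FactorsL2Mixed37Dir)
open Literature.MathematicalPhysics.QuantumFieldTheory.Balaban1983to89.B9RWSums346SecondDiffGp (DirOps37)
open Literature.MathematicalPhysics.QuantumFieldTheory.Balaban1983to89.B6Cover236MultiLevelBlocks (cubes)
open Literature.MathematicalPhysics.QuantumFieldTheory.Balaban1983to89.B9WalkLettersCoordsS (hWalkY gsqcoS)
open Literature.MathematicalPhysics.QuantumFieldTheory.Balaban1983to89.B9RWSums346MixedFactorAtRecord (factorsL2Mixed37Dir_memberY_record)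
open scoped Matrix Matrix.Norms.L2Operator

variable (d ℓ : ℕ) (hd : 1 ≤ d + 1) (hL : Odd (ℓ + 1) ∧ 1 < ℓ + 1) (b₀ b₁ : ℝ) (Mstar : ℕ)
variable [∀ x : MemberY d ℓ hd hL b₀ b₁ Mstar, Fintype (geo9Y x).Site] (N : ℕ) [NeZero N] (c₀ : ℝ) (hc₀ : 0 < c₀)

/-- **THE MEMBER THRESHOLD `M_K` OF ROWS 18's MIXED FACTOR AT THE RECORD, NAMED** (first existential constant of `factorsL2Mixed37Dir_memberY_record`: the legs' threshold
and the two Lemma-2.1 thresholds, at least `1`). [cite: Balaban1985BackgroundPropagators, (3.89) p.409, Cor 3.6 p.408; Balaban1984PropagatorsII, (2.59) p.233] -/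
def MRec : ℝ := (factorsL2Mixed37Dir_memberY_record d ℓ hd hL b₀ b₁ Mstar N hc₀).choose

/-- **THE SMALLNESS THRESHOLD `a_K` (`c₀·M·α₀ ≤ a_K`), NAMED** (second existential constant). [cite: Balaban1985BackgroundPropagators, (3.35) p.396, Cor 3.6 p.408] -/
def aRec : ℝ := (factorsL2Mixed37Dir_memberY_record d ℓ hd hL b₀ b₁ Mstar N hc₀).choose_spec.choose

/-- **THE CONSTANT `B_K`, NAMED** (third existential constant; print's `O(1)` of (3.46) at `G′_□` times the (2.61) constant and the scale factors, so that the schema's constant is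
`θ₀·e^{(3/4+ρ′)ρ}·B_K`). [cite: Balaban1985BackgroundPropagators, (3.46) p.398, (3.89) p.409, Cor 3.6 p.408; Balaban1984PropagatorsII, (2.61) p.234] -/
def BRec : ℝ := (factorsL2Mixed37Dir_memberY_record d ℓ hd hL b₀ b₁ Mstar N hc₀).choose_spec.choose_spec.choose

/-- **THE ADMISSIBLE TARGET RATE `δ_K`, NAMED** (fourth existential constant) — the closed term the rate condition `ρ′ ≤ δ_K` (at the certificate: `p.δ₀ ≤ δ_K`) refers to.
[cite: Balaban1985BackgroundPropagators, (3.46) p.398, Cor 3.6 p.408] -/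
def δRec : ℝ := (factorsL2Mixed37Dir_memberY_record d ℓ hd hL b₀ b₁ Mstar N hc₀).choose_spec.choose_spec.choose_spec.choose

/-- The defining property of the four named constants (this seat's theorem, unpacked once). [cite: Balaban1985BackgroundPropagators, (3.89) p.409, bookkeeping] -/
private theorem specRec : 0 < MRec d ℓ hd hL b₀ b₁ Mstar N c₀ hc₀ ∧ 0 < aRec d ℓ hd hL b₀ b₁ Mstar N c₀ hc₀ ∧ 0 < BRec d ℓ hd hL b₀ b₁ Mstar N c₀ hc₀ ∧ 0 < δRec d ℓ hd hL b₀ b₁ Mstar N c₀ hc₀ ∧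
    ∀ {G : Subgroup (Matrix (Fin N) (Fin N) ℂ)ˣ} (_ : G ≤ B7Prop2Explicit.unitaryUnits (Matrix (Fin N) (Fin N) ℂ))
        (x : MemberY d ℓ hd hL b₀ b₁ Mstar), MRec d ℓ hd hL b₀ b₁ Mstar N c₀ hc₀ ≤ (geo9Y x).M → ∀ α₀ : ℝ, 0 < α₀ → c₀ * (geo9Y x).M * α₀ ≤ aRec d ℓ hd hL b₀ b₁ Mstar N c₀ hc₀ →
      ∀ (U : (bg9Y (Matrix (Fin N) (Fin N) ℂ) G x).Cfg), (bg9Y (Matrix (Fin N) (Fin N) ℂ) G x).Reg335 c₀ α₀ U →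
      ∀ {bI : FBondY x.toKIdx → IBondY x.toKIdx} (_ : ∀ f, lvl x.hN x.D x.hk (bI f) = (blkV1 x.hN x.D f).1.1)
        (_ : ∀ f, (geomT x.D).dist (β x.hN x.D x.hk (bI f)) (blkV1 x.hN x.D f) ≤ 1) (H₀ : Prop) [DecidableEq (geo9Y x).Site]
        {Y : Type} [Fintype Y] (𝔬 : Ops (geo9Y x) (bg9Y (Matrix (Fin N) (Fin N) ℂ) G x) (XSK (TrIdx N) x.toKIdx) Y ↥(cubes x.toKIdx.D.toDomains))
        (𝔡 : DirOps37 𝔬 (Fin (d + 1))) (𝔩 : DirLetters37 𝔬 (Fin (d + 1)))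
        (_ : 𝔬.blk = blkSK x.toKIdx (sIK x.toKIdx bI)) (_ : ∀ c, 𝔬.h c = hWalkY x c)
        (_ : ∀ c, 𝔬.Gsq U c = gsqcoS x (trBasis N) (bg9Y (Matrix (Fin N) (Fin N) ℂ) G x) (fun U => U) (parSymY x.toKIdx) c U)
        (_ : ∀ ν, 𝔡.Dd U ν = (etaS x.toKIdx)⁻¹ • coordOpK (trBasis N) (fun _ : Fin (d + 1) => (cdSL x.toKIdx U ν).restrictScalars ℝ))
        (_ : ∀ μ, 𝔡.Dsd U μ = (etaS x.toKIdx)⁻¹ • coordOpK (trBasis N) (fun _ : Fin (d + 1) => (cdsSL x.toKIdx U μ).restrictScalars ℝ))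
        {ρ Nn N' Cℓ Kc θ₀ : ℝ} {κ : Sizes} (_ : StaticOK 𝔬 ρ Nn N' Cℓ κ) (_ : κ.Bounded Kc θ₀ Cℓ (geo9Y x).M) (_ : 0 ≤ θ₀) (_ : 1 ≤ Cℓ)
        (_ : Identities₂ 𝔬 𝔡 𝔩 1 H₀ U)
        (_ : ∀ c ν, IsTransposePair (𝔩.Pt U c ν) (𝔩.P U c ν)) (_ : ∀ c, IsTransposePair (𝔬.Ct U c) (𝔬.Cop U c))
        {ρ' : ℝ} (_ : 0 ≤ ρ') (_ : ρ' ≤ δRec d ℓ hd hL b₀ b₁ Mstar N c₀ hc₀),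
        FactorsL2Mixed37Dir 𝔬 𝔡 𝔩 1 H₀ (θ₀ * Real.exp ((3 / 4 + ρ') * ρ) * BRec d ℓ hd hL b₀ b₁ Mstar N c₀ hc₀) ρ' U :=
  (factorsL2Mixed37Dir_memberY_record d ℓ hd hL b₀ b₁ Mstar N hc₀).choose_spec.choose_spec.choose_spec.choose_spec

/-- `0 < MRec`. [cite: Balaban1985BackgroundPropagators, Cor 3.6 p.408, bookkeeping] -/
theorem MRec_pos : 0 < MRec d ℓ hd hL b₀ b₁ Mstar N c₀ hc₀ := (specRec d ℓ hd hL b₀ b₁ Mstar N c₀ hc₀).1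

/-- `0 < aRec`. [cite: Balaban1985BackgroundPropagators, Cor 3.6 p.408, bookkeeping] -/
theorem aRec_pos : 0 < aRec d ℓ hd hL b₀ b₁ Mstar N c₀ hc₀ := (specRec d ℓ hd hL b₀ b₁ Mstar N c₀ hc₀).2.1

/-- `0 < BRec`. [cite: Balaban1985BackgroundPropagators, Cor 3.6 p.408, bookkeeping] -/
theorem BRec_pos : 0 < BRec d ℓ hd hL b₀ b₁ Mstar N c₀ hc₀ := (specRec d ℓ hd hL b₀ b₁ Mstar N c₀ hc₀).2.2.1

/-- `0 < δRec`. [cite: Balaban1985BackgroundPropagators, Cor 3.6 p.408, bookkeeping] -/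
theorem δRec_pos : 0 < δRec d ℓ hd hL b₀ b₁ Mstar N c₀ hc₀ := (specRec d ℓ hd hL b₀ b₁ Mstar N c₀ hc₀).2.2.2.1

/-- ★★★ **ROWS 18's `FactorsL2Mixed37Dir` AT THE RECORD, AT THE NAMED CONSTANTS** — `factorsL2Mixed37Dir_memberY_record` with `MK aK BK δK` replaced by the closed terms
`MRec aRec BRec δRec`: same prefix, same pins, same displayed data (`StaticOK`, `Sizes.Bounded`, `Identities₂`, the two transposes in the certificate's order), same conclusion
`FactorsL2Mixed37Dir 𝔬 𝔡 𝔩 1 H₀ (θ₀ * exp ((3/4 + ρ′) * ρ) * BRec) ρ′ U` for `0 ≤ ρ′ ≤ δRec`. [cite: Balaban1985BackgroundPropagators, (3.88)–(3.89) p.409, (3.46) p.398, Cor 3.6 p.408, (3.35) p.396; Balaban1984PropagatorsII, (2.39)–(2.44) pp.229–230, (2.52)–(2.55) p.232, Lemma 2.1 (2.59)–(2.61) pp.233–234] -/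
theorem factorsL2Mixed37Dir_memberY_record_at :
    ∀ {G : Subgroup (Matrix (Fin N) (Fin N) ℂ)ˣ} (_ : G ≤ B7Prop2Explicit.unitaryUnits (Matrix (Fin N) (Fin N) ℂ))
        (x : MemberY d ℓ hd hL b₀ b₁ Mstar), MRec d ℓ hd hL b₀ b₁ Mstar N c₀ hc₀ ≤ (geo9Y x).M → ∀ α₀ : ℝ, 0 < α₀ → c₀ * (geo9Y x).M * α₀ ≤ aRec d ℓ hd hL b₀ b₁ Mstar N c₀ hc₀ →
      ∀ (U : (bg9Y (Matrix (Fin N) (Fin N) ℂ) G x).Cfg), (bg9Y (Matrix (Fin N) (Fin N) ℂ) G x).Reg335 c₀ α₀ U →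
      ∀ {bI : FBondY x.toKIdx → IBondY x.toKIdx} (_ : ∀ f, lvl x.hN x.D x.hk (bI f) = (blkV1 x.hN x.D f).1.1)
        (_ : ∀ f, (geomT x.D).dist (β x.hN x.D x.hk (bI f)) (blkV1 x.hN x.D f) ≤ 1) (H₀ : Prop) [DecidableEq (geo9Y x).Site]
        {Y : Type} [Fintype Y] (𝔬 : Ops (geo9Y x) (bg9Y (Matrix (Fin N) (Fin N) ℂ) G x) (XSK (TrIdx N) x.toKIdx) Y ↥(cubes x.toKIdx.D.toDomains))
        (𝔡 : DirOps37 𝔬 (Fin (d + 1))) (𝔩 : DirLetters37 𝔬 (Fin (d + 1)))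
        (_ : 𝔬.blk = blkSK x.toKIdx (sIK x.toKIdx bI)) (_ : ∀ c, 𝔬.h c = hWalkY x c)
        (_ : ∀ c, 𝔬.Gsq U c = gsqcoS x (trBasis N) (bg9Y (Matrix (Fin N) (Fin N) ℂ) G x) (fun U => U) (parSymY x.toKIdx) c U)
        (_ : ∀ ν, 𝔡.Dd U ν = (etaS x.toKIdx)⁻¹ • coordOpK (trBasis N) (fun _ : Fin (d + 1) => (cdSL x.toKIdx U ν).restrictScalars ℝ))
        (_ : ∀ μ, 𝔡.Dsd U μ = (etaS x.toKIdx)⁻¹ • coordOpK (trBasis N) (fun _ : Fin (d + 1) => (cdsSL x.toKIdx U μ).restrictScalars ℝ))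
        {ρ Nn N' Cℓ Kc θ₀ : ℝ} {κ : Sizes} (_ : StaticOK 𝔬 ρ Nn N' Cℓ κ) (_ : κ.Bounded Kc θ₀ Cℓ (geo9Y x).M) (_ : 0 ≤ θ₀) (_ : 1 ≤ Cℓ)
        (_ : Identities₂ 𝔬 𝔡 𝔩 1 H₀ U)
        (_ : ∀ c ν, IsTransposePair (𝔩.Pt U c ν) (𝔩.P U c ν)) (_ : ∀ c, IsTransposePair (𝔬.Ct U c) (𝔬.Cop U c))
        {ρ' : ℝ} (_ : 0 ≤ ρ') (_ : ρ' ≤ δRec d ℓ hd hL b₀ b₁ Mstar N c₀ hc₀),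
        FactorsL2Mixed37Dir 𝔬 𝔡 𝔩 1 H₀ (θ₀ * Real.exp ((3 / 4 + ρ') * ρ) * BRec d ℓ hd hL b₀ b₁ Mstar N c₀ hc₀) ρ' U :=
  (specRec d ℓ hd hL b₀ b₁ Mstar N c₀ hc₀).2.2.2.2

end Literature.MathematicalPhysics.QuantumFieldTheory.Balaban1983to89.B9RWSums346MixedFactorAtRecordClosed

end
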